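import Mathlib
import HarnessLib
import Literature.Analysis.FluidPDE.LocalPressureLiouville
import Literature.Analysis.FluidPDE.TsaiSelfSimilarBounded
/-!
# Route `PoloidalWindowDoor`, crux `PoloidalWindowRigidity` (K2, stmt-NavierStokesRegularity-19708) —
# THE PRESSURE GAUGE OF A SLICE, TOOLS: Liouville for bounded distributionally-harmonic functions; continuity
# and centre-uniform bounds for the two parts of the mollified pressure-gradient functional

Cell ns-regularity-ideate, seat nsreg-p7 (gen 6, third worker under the K2 lead; `--supports stmt-…-19708`).
Tool file for `…PressureGauge.lean` (first brick of the discharge of the K2 lead's hypothesis (F1), the mean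
oscillation bound for the class pressure in `…LargeScaleEnergy.exists_largeScale_energy_bound`).

For a measurable uniformly locally `L²` field `w : ℝ³ → ℝ³` and `q ∈ L¹_loc(ℝ³)` the **slice functional** is

  `g(c) := ∫ [q(x) ∂ₑλ_δ(c − x) + D³Φ_δ(c − x)(e)(w x, w x)] dx`

(`Φ_δ = newtonReg δ`, `λ_δ = ΔΦ_δ`; the tree's `slice_pressure_oscillation_le` consumes `g ≡ 0`). Here:

* `eq_of_bounded_of_laplacian_normed_convolution_eq_zero` — **Liouville**: a continuous bounded `F : ℝ³ → ℝ`
  all of whose bump-mollifications `ψ ⋆ F` have vanishing Laplacian is constant (each `ψ ⋆ F` is `C²`, bounded,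
  harmonic ⇒ constant by the tree's `isConst_of_harmonic_bounded`; `ψₙ ⋆ F → F`);
* `continuous_pressureTerm`, `continuous_sliceFunctional` — continuity of `c ↦ ∫ q ∂ₑλ_δ(c − ·)` (a
  convolution `L¹_loc ⋆ C_c`) and of `g` (with the tree's `continuous_integral_evalDiag_fderiv3_newtonReg`);
* `abs_velocityTerm_le` — `|∫ D³Φ_δ(c − y)(e)(w y, w y) dy| ≤ K` uniformly in `c` (kernel decay `O(|z|⁻⁴)`
  against the uniformly local energy);
* `abs_pressureTerm_le_of_norm_fderiv_le` — for `q ∈ C¹` with `‖Dq‖ ≤ L`: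
  `|∫ q(x) ∂ₑλ_δ(c − x) dx| ≤ L ‖e‖ ∫|λ_δ|` uniformly in `c` (one integration by parts).

WHAT THIS IS NOT: not a claim about Navier–Stokes regularity and not the open residue S2⁗ — measure theory
and potential theory of one time slice (bears_on LADDER-NS N0 via crux K2 = stmt-19708; whole-class tool).
-/

noncomputable section

-- the summit and its single sub-problem share the name (CONVENTIONS §1), as in every Theorems file
set_option linter.dupNamespace false
-- nested operator types `ℝ³ →L[ℝ] ℝ³ →L[ℝ] ℝ³ →L[ℝ] ℝ` (as in `LocalPressureLiouvilleKernel.lean`)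
set_option maxSynthPendingDepth 3

namespace Summit.NavierStokesRegularity.NavierStokesRegularity.Theorems.PoloidalWindowDoorPoloidalWindowRigidityPressureGaugeTools

open MeasureTheory Set Function Filter Topology Metric InnerProductSpace
open scoped RealInnerProductSpace ENNReal NNReal Laplacian ContDiff Convolution
open Literature.Analysis Literature.Analysis.FluidPDE


/-! ## Liouville for bounded functions with harmonic mollifications -/

/-- A mollification by a (mass-one, nonnegative) bump of a function bounded by `B` is bounded by `B`.
[folklore] -/
theorem abs_normed_convolution_le (φ : ContDiffBump (0 : EuclideanSpace ℝ (Fin 3)))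
    {F : EuclideanSpace ℝ (Fin 3) → ℝ} (hF : Continuous F) {B : ℝ} (hB : ∀ c, |F c| ≤ B)
    (b : EuclideanSpace ℝ (Fin 3)) :
    |(φ.normed volume ⋆[ContinuousLinearMap.lsmul ℝ ℝ, volume] F) b| ≤ B := by
  rw [convolution_lsmul_apply]
  have hbound : ∀ s, ‖φ.normed volume s * F (b - s)‖ ≤ φ.normed volume s * B := by
    intro s
    rw [norm_mul, Real.norm_eq_abs, abs_of_nonneg (φ.nonneg_normed s), Real.norm_eq_abs]
    exact mul_le_mul_of_nonneg_left (hB _) (φ.nonneg_normed s)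
  have hi : Integrable (fun s => φ.normed volume s * F (b - s)) volume :=
    (φ.continuous_normed.mul (hF.comp (continuous_const.sub continuous_id))).integrable_of_hasCompactSupport
      (φ.hasCompactSupport_normed.mul_right)
  calc |∫ s, φ.normed volume s * F (b - s)| = ‖∫ s, φ.normed volume s * F (b - s)‖ := (Real.norm_eq_abs _).symm
    _ ≤ ∫ s, φ.normed volume s * B := norm_integral_le_of_norm_le (φ.integrable_normed.mul_const _)
        (Eventually.of_forall hbound)
    _ = B := by rw [integral_mul_const, φ.integral_normed, one_mul]

/-- **Liouville for bounded «distributionally harmonic» continuous functions.** If `F : ℝ³ → ℝ` is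
continuous and bounded and every bump-mollification `ψ ⋆ F` (`ψ = φ.normed`, `φ` a Mathlib bump) has
vanishing Laplacian everywhere, then `F` is constant: each `ψ ⋆ F` is `C²`, harmonic and bounded, hence
constant (`isConst_of_harmonic_bounded`, Gilbarg–Trudinger Thm 2.10), and `F = lim ψₙ ⋆ F`. [folklore] -/
theorem eq_of_bounded_of_laplacian_normed_convolution_eq_zero {F : EuclideanSpace ℝ (Fin 3) → ℝ}
    (hF : Continuous F) (hB : ∃ B, ∀ c, |F c| ≤ B)
    (hΔ : ∀ (φ : ContDiffBump (0 : EuclideanSpace ℝ (Fin 3))) (b : EuclideanSpace ℝ (Fin 3)),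
      Δ (φ.normed volume ⋆[ContinuousLinearMap.lsmul ℝ ℝ, volume] F) b = 0)
    (c c' : EuclideanSpace ℝ (Fin 3)) : F c = F c' := by
  obtain ⟨B, hB⟩ := hB
  have hconst : ∀ φ : ContDiffBump (0 : EuclideanSpace ℝ (Fin 3)),
      (φ.normed volume ⋆[ContinuousLinearMap.lsmul ℝ ℝ, volume] F) c =
        (φ.normed volume ⋆[ContinuousLinearMap.lsmul ℝ ℝ, volume] F) c' := by
    intro φ
    have h2 : ContDiff ℝ 2 (φ.normed volume ⋆[ContinuousLinearMap.lsmul ℝ ℝ, volume] F) :=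
      φ.hasCompactSupport_normed.contDiff_convolution_left _ φ.contDiff_normed hF.locallyIntegrable
    exact isConst_of_harmonic_bounded (harmonicOnNhd_of_laplacian_eq_zero h2 (hΔ φ))
      ⟨B, abs_normed_convolution_le φ hF hB⟩ c c'
  obtain ⟨φs, hφs, -⟩ := FunctionSpaces.exists_contDiffBump_seq (E := EuclideanSpace ℝ (Fin 3))
  have hlim := ContDiffBump.convolution_tendsto_right_of_continuous (μ := volume) hφs hF c
  have hlim' := ContDiffBump.convolution_tendsto_right_of_continuous (μ := volume) hφs hF c'
  have heq : (fun n => ((φs n).normed volume ⋆[ContinuousLinearMap.lsmul ℝ ℝ, volume] F) c) =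
      fun n => ((φs n).normed volume ⋆[ContinuousLinearMap.lsmul ℝ ℝ, volume] F) c' := by
    funext n; exact hconst (φs n)
  rw [heq] at hlim
  exact tendsto_nhds_unique hlim hlim'

/-! ## The slice functional: continuity and the bound on its velocity part -/

section Slice

variable {δ : ℝ} {w : EuclideanSpace ℝ (Fin 3) → EuclideanSpace ℝ (Fin 3)} {A : ℝ≥0∞}
  {q : EuclideanSpace ℝ (Fin 3) → ℝ}

/-- The profile `z ↦ ∂ₑλ_δ(z)` is continuous and supported in `B̄(0, δ)`. [folklore] -/
theorem continuous_and_hasCompactSupport_fderiv_profile (hδ : 0 < δ) (e : EuclideanSpace ℝ (Fin 3)) :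
    Continuous (fun z : EuclideanSpace ℝ (Fin 3) => fderiv ℝ (Δ (newtonReg δ)) z e) ∧
      HasCompactSupport (fun z : EuclideanSpace ℝ (Fin 3) => fderiv ℝ (Δ (newtonReg δ)) z e) := by
  refine ⟨((contDiff_laplacian_newtonReg hδ (n := 1)).continuous_fderiv one_ne_zero).clm_apply
    continuous_const, ?_⟩
  refine HasCompactSupport.intro (isCompact_closedBall (0 : EuclideanSpace ℝ (Fin 3)) δ) fun z hz => ?_
  rw [mem_closedBall_zero_iff, not_le] at hz
  rw [fderiv_laplacian_newtonReg_eq_zero hδ hz, _root_.zero_apply]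

/-- The shifted profile `x ↦ ∂ₑλ_δ(c − x)` is continuous and supported in `B̄(c, δ)`. [folklore] -/
theorem continuous_and_hasCompactSupport_profile_comp_sub (hδ : 0 < δ) (c e : EuclideanSpace ℝ (Fin 3)) :
    Continuous (fun x : EuclideanSpace ℝ (Fin 3) => fderiv ℝ (Δ (newtonReg δ)) (c - x) e) ∧
      HasCompactSupport (fun x : EuclideanSpace ℝ (Fin 3) => fderiv ℝ (Δ (newtonReg δ)) (c - x) e) := by
  obtain ⟨hc, -⟩ := continuous_and_hasCompactSupport_fderiv_profile hδ e
  refine ⟨hc.comp (continuous_const.sub continuous_id :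
    Continuous fun x : EuclideanSpace ℝ (Fin 3) => c - x), ?_⟩
  refine HasCompactSupport.intro (isCompact_closedBall c δ) fun x hx => ?_
  rw [mem_closedBall, dist_eq_norm, not_le, ← norm_sub_rev] at hx
  rw [fderiv_laplacian_newtonReg_eq_zero hδ hx, _root_.zero_apply]

/-- The pressure integrand `x ↦ q(x) ∂ₑλ_δ(c − x)` is integrable for `q ∈ L¹_loc`. [folklore] -/
theorem integrable_pressureTerm (hδ : 0 < δ) (hq : LocallyIntegrable q volume)
    (c e : EuclideanSpace ℝ (Fin 3)) :
    Integrable (fun x => q x * fderiv ℝ (Δ (newtonReg δ)) (c - x) e) volume := by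
  obtain ⟨hc, hs⟩ := continuous_and_hasCompactSupport_profile_comp_sub hδ c e
  have h := hq.integrable_smul_right_of_hasCompactSupport hc hs
  simpa only [smul_eq_mul] using h

/-- The pressure part of the slice functional is the convolution `q ⋆ ∂ₑλ_δ`. [folklore] -/
theorem pressureTerm_eq_convolution (q : EuclideanSpace ℝ (Fin 3) → ℝ) (δ : ℝ)
    (c e : EuclideanSpace ℝ (Fin 3)) :
    ∫ x, q x * fderiv ℝ (Δ (newtonReg δ)) (c - x) e =
      (q ⋆[ContinuousLinearMap.lsmul ℝ ℝ, volume]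
        (fun z : EuclideanSpace ℝ (Fin 3) => fderiv ℝ (Δ (newtonReg δ)) z e)) c := by
  rw [convolution_lsmul_apply]

/-- **Continuity of the pressure part** `c ↦ ∫ q(x) ∂ₑλ_δ(c − x) dx` for `q ∈ L¹_loc` (a convolution of
a locally integrable function with a continuous compactly supported one). [folklore] -/
theorem continuous_pressureTerm (hδ : 0 < δ) (hq : LocallyIntegrable q volume)
    (e : EuclideanSpace ℝ (Fin 3)) :
    Continuous fun c : EuclideanSpace ℝ (Fin 3) => ∫ x, q x * fderiv ℝ (Δ (newtonReg δ)) (c - x) e := by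
  obtain ⟨hc, hs⟩ := continuous_and_hasCompactSupport_fderiv_profile hδ e
  have h := hs.continuous_convolution_right (ContinuousLinearMap.lsmul ℝ ℝ) hq hc
  refine h.congr fun c => ?_
  rw [pressureTerm_eq_convolution]

/-- **Continuity of the slice functional**
`c ↦ ∫ [q(x) ∂ₑλ_δ(c − x) + D³Φ_δ(c − x)(e)(w x, w x)] dx` for a measurable uniformly locally `L²`
field `w` and `q ∈ L¹_loc`. [folklore] -/
theorem continuous_sliceFunctional (hδ : 0 < δ) (hw : AEStronglyMeasurable w volume) (hAtop : A ≠ ⊤)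
    (hA : ∀ z : EuclideanSpace ℝ (Fin 3), ∫⁻ y in ball z 1, ‖w y‖ₑ ^ 2 ≤ A)
    (hq : LocallyIntegrable q volume) (e : EuclideanSpace ℝ (Fin 3)) :
    Continuous fun c : EuclideanSpace ℝ (Fin 3) => ∫ x, (q x * fderiv ℝ (Δ (newtonReg δ)) (c - x) e +
      evalDiag (w x) (fderiv ℝ (fderiv ℝ (fderiv ℝ (newtonReg δ))) (c - x) e)) := by
  have h1 := continuous_pressureTerm hδ hq e
  have h2 := continuous_integral_evalDiag_fderiv3_newtonReg hδ hw hAtop hA e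
  refine (h1.add h2).congr fun c => ?_
  have hi1 : Integrable (fun x => q x * fderiv ℝ (Δ (newtonReg δ)) (c - x) e) volume :=
    integrable_pressureTerm hδ hq c e
  have hi2 := integrable_evalDiag_fderiv3_newtonReg hδ hw hAtop hA c e
  exact (integral_add hi1 hi2).symm

/-- **The velocity part is bounded uniformly in the centre:** `|∫ D³Φ_δ(c − y)(e)(w y, w y) dy| ≤ K`
with `K = C_δ ‖e‖ (C_w A).toReal` independent of `c` (kernel decay `O(|z|⁻⁴)` against a uniformly local
`L²` field). [folklore] -/
theorem abs_velocityTerm_le (hδ : 0 < δ) (hw : AEStronglyMeasurable w volume) (hAtop : A ≠ ⊤)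
    (hA : ∀ z : EuclideanSpace ℝ (Fin 3), ∫⁻ y in ball z 1, ‖w y‖ₑ ^ 2 ≤ A) (e : EuclideanSpace ℝ (Fin 3)) :
    ∃ K : ℝ, ∀ c : EuclideanSpace ℝ (Fin 3),
      |∫ y, evalDiag (w y) (fderiv ℝ (fderiv ℝ (fderiv ℝ (newtonReg δ))) (c - y) e)| ≤ K := by
  obtain ⟨Cw, hCwtop, hCw⟩ := exists_lintegral_mul_inv_one_add_norm_pow_le
  obtain ⟨C, hC0, hC⟩ := exists_norm_fderiv3_newtonReg_le_inv hδ
  refine ⟨C * ‖e‖ * (Cw * A).toReal, fun c => ?_⟩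
  obtain ⟨hint, hle⟩ := integrable_inv_one_add_norm_pow_mul_norm_sq hCwtop hCw hw hAtop hA c
  have hpt : ∀ y, ‖evalDiag (w y) (fderiv ℝ (fderiv ℝ (fderiv ℝ (newtonReg δ))) (c - y) e)‖ ≤
      C * ‖e‖ * (((1 + ‖y - c‖) ^ 4)⁻¹ * ‖w y‖ ^ 2) := by
    intro y
    rw [norm_sub_rev y c]
    calc ‖evalDiag (w y) (fderiv ℝ (fderiv ℝ (fderiv ℝ (newtonReg δ))) (c - y) e)‖
        ≤ ‖evalDiag (w y)‖ * ‖fderiv ℝ (fderiv ℝ (fderiv ℝ (newtonReg δ))) (c - y) e‖ :=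
          ContinuousLinearMap.le_opNorm _ _
      _ ≤ ‖w y‖ ^ 2 * (C * ((1 + ‖c - y‖) ^ 4)⁻¹ * ‖e‖) := by
          refine mul_le_mul (norm_evalDiag_le _) ?_ (norm_nonneg _) (by positivity)
          exact (ContinuousLinearMap.le_opNorm _ _).trans
            (mul_le_mul_of_nonneg_right (hC _) (norm_nonneg _))
      _ = C * ‖e‖ * (((1 + ‖c - y‖) ^ 4)⁻¹ * ‖w y‖ ^ 2) := by ring
  calc |∫ y, evalDiag (w y) (fderiv ℝ (fderiv ℝ (fderiv ℝ (newtonReg δ))) (c - y) e)|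
      = ‖∫ y, evalDiag (w y) (fderiv ℝ (fderiv ℝ (fderiv ℝ (newtonReg δ))) (c - y) e)‖ :=
        (Real.norm_eq_abs _).symm
    _ ≤ ∫ y, C * ‖e‖ * (((1 + ‖y - c‖) ^ 4)⁻¹ * ‖w y‖ ^ 2) :=
        norm_integral_le_of_norm_le (hint.const_mul _) (Eventually.of_forall hpt)
    _ = C * ‖e‖ * ∫ y, ((1 + ‖y - c‖) ^ 4)⁻¹ * ‖w y‖ ^ 2 := integral_const_mul _ _
    _ ≤ C * ‖e‖ * (Cw * A).toReal := mul_le_mul_of_nonneg_left hle (by positivity)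

/-- **The pressure part is bounded when `∇q` is:** for `q ∈ C¹` with `‖Dq‖ ≤ L`,
`|∫ q(x) ∂ₑλ_δ(c − x) dx| ≤ L ‖e‖ ∫ |λ_δ|` for every centre `c` (one integration by parts onto the
compactly supported profile, then translation invariance). [folklore] -/
theorem abs_pressureTerm_le_of_norm_fderiv_le (hδ : 0 < δ) (hq : ContDiff ℝ 1 q) {L : ℝ}
    (hL : ∀ x, ‖fderiv ℝ q x‖ ≤ L) (c e : EuclideanSpace ℝ (Fin 3)) :
    |∫ x, q x * fderiv ℝ (Δ (newtonReg δ)) (c - x) e| ≤ L * ‖e‖ * ∫ z, |Δ (newtonReg δ) z| := by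
  set lam : EuclideanSpace ℝ (Fin 3) → ℝ := Δ (newtonReg δ) with hlam
  have hl1 : ContDiff ℝ 1 lam := contDiff_laplacian_newtonReg hδ (n := 1)
  have hls : HasCompactSupport lam := hasCompactSupport_laplacian_newtonReg hδ
  have hL0 : 0 ≤ L := (norm_nonneg _).trans (hL 0)
  -- the shifted profile `g(x) = λ_δ(c - x)` and its derivative
  set g : EuclideanSpace ℝ (Fin 3) → ℝ := fun x => lam (c - x) with hg
  have hg1 : ContDiff ℝ 1 g := hl1.comp (contDiff_const.sub contDiff_id)
  have hgs : HasCompactSupport g := by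
    refine HasCompactSupport.intro (isCompact_closedBall c δ) fun x hx => ?_
    rw [mem_closedBall, dist_eq_norm, not_le, ← norm_sub_rev] at hx
    exact laplacian_newtonReg_eq_zero hδ hx
  have hgd : ∀ x, fderiv ℝ g x e = -(fderiv ℝ lam (c - x) e) := by
    intro x
    rw [hg, fderiv_comp_const_sub lam c x, _root_.neg_apply]
  -- integration by parts `∫ q ∂ₑg = -∫ ∂ₑq g`
  have hqc : Continuous q := hq.continuous
  have hqD : Continuous fun x => fderiv ℝ q x e := (hq.continuous_fderiv one_ne_zero).clm_apply
    continuous_const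
  have hgD : Continuous fun x => fderiv ℝ g x e := (hg1.continuous_fderiv one_ne_zero).clm_apply
    continuous_const
  have i1 : Integrable (fun x => fderiv ℝ q x e * g x) :=
    (hqD.mul hg1.continuous).integrable_of_hasCompactSupport hgs.mul_left
  have i2 : Integrable (fun x => q x * fderiv ℝ g x e) :=
    (hqc.mul hgD).integrable_of_hasCompactSupport (hgs.fderiv_apply (𝕜 := ℝ) e).mul_left
  have i3 : Integrable (fun x => q x * g x) :=
    (hqc.mul hg1.continuous).integrable_of_hasCompactSupport hgs.mul_left
  have hibp := integral_mul_fderiv_eq_neg_fderiv_mul_of_integrable (μ := volume) i1 i2 i3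
    (fun x _ => hq.differentiable one_ne_zero x) (fun x _ => hg1.differentiable one_ne_zero x)
  have hrw : ∫ x, q x * fderiv ℝ lam (c - x) e = ∫ x, fderiv ℝ q x e * g x := by
    have h1 : (fun x => q x * fderiv ℝ lam (c - x) e) = fun x => -(q x * fderiv ℝ g x e) := by
      funext x; rw [hgd]; ring
    rw [h1, integral_neg, hibp, neg_neg]
  rw [hrw]
  -- bound and translate
  have hpt : ∀ x, ‖fderiv ℝ q x e * g x‖ ≤ L * ‖e‖ * |lam (c - x)| := by
    intro x
    rw [norm_mul, Real.norm_eq_abs, Real.norm_eq_abs]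
    refine mul_le_mul_of_nonneg_right ?_ (abs_nonneg _)
    calc |fderiv ℝ q x e| = ‖fderiv ℝ q x e‖ := (Real.norm_eq_abs _).symm
      _ ≤ ‖fderiv ℝ q x‖ * ‖e‖ := ContinuousLinearMap.le_opNorm _ _
      _ ≤ L * ‖e‖ := mul_le_mul_of_nonneg_right (hL x) (norm_nonneg _)
  have hint : Integrable (fun x => L * ‖e‖ * |lam (c - x)|) volume :=
    ((continuous_const.mul (continuous_abs.comp hg1.continuous)).integrable_of_hasCompactSupport
      (hgs.norm.mul_left))
  calc |∫ x, fderiv ℝ q x e * g x| = ‖∫ x, fderiv ℝ q x e * g x‖ := (Real.norm_eq_abs _).symm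
    _ ≤ ∫ x, L * ‖e‖ * |lam (c - x)| := norm_integral_le_of_norm_le hint (Eventually.of_forall hpt)
    _ = L * ‖e‖ * ∫ x, |lam (c - x)| := integral_const_mul _ _
    _ = L * ‖e‖ * ∫ z, |lam z| := by
        congr 1
        exact integral_sub_left_eq_self (fun z => |lam z|) volume c

end Slice

end Summit.NavierStokesRegularity.NavierStokesRegularity.Theorems.PoloidalWindowDoorPoloidalWindowRigidityPressureGaugeTools

end
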